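import Summits.ResolutionOfSingularities.ResolutionOfSingularities.Theorems.EquisingularLiftEquisingularLiftNatConeRoundTransport
import Literature.AlgebraicGeometry.Resolution.BlowupChartMembership
import Literature.AlgebraicGeometry.Resolution.AlterationsSectionDivisor
import Literature.AlgebraicGeometry.Resolution.StalkIdealLemmas
import Literature.AlgebraicGeometry.Resolution.QuasiRegularSequences
import Literature.AlgebraicGeometry.Resolution.BlowupsLocal
import Literature.AlgebraicGeometry.Resolution.SpreadRestrict
import HarnessLib

/-!
# [OURS · L1 W4.5(b) · EL♮(3)] S6 (d) — THE TRANSPORTED CENTRE of a Čech round at a NON-birth stage of `DirLift.Ruled`: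
# `C̃ := 𝓔 ⊔ C₁·𝒪_X` for a centre `C₁ ⊇ E₁` inside the root's exceptional divisor and the isomorphism `V(𝓔) ≅ V(E₁)` over `ρ : X ⟶ X₁`

Crux chain w45b (cell `res-hironaka`, slot W4.5(b)), working crux **EL♮** = stmt-ResolutionOfSingularities-20038, child **EL♮(3)** =
stmt-ResolutionOfSingularities-20148, route EquisingularLift, line `sections`; rung TOWER₃, (round) clause, Čech disjunct (029's stand-in S6 `hCech`,
proof → res-D-pv-057 g9; decomposition note STATUS 2026-08-27T20:25:39Z, part (d)). Written by res-L1-w45b-stub-2 g7. HONEST FRAMING: OURS; NOT a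
statement of any manuscript; AI-written, weaker than expert review. No `sorry`; standard axioms; DEF-FREE. `--supports stmt-ResolutionOfSingularities-20148 --as helper`.

SETTING (root-local, as `DirLift.Ruled` R1′ delivers it): `ρ : X ⟶ X₁`, an ideal sheaf `𝓔` on `X` (the current exceptional surface) and `E₁ ≤ C₁` on `X₁`
(the root's exceptional divisor `E₁ = I·𝒪_{X₁}` and, inside it, the lifted section `C₁ = controlledTransform τ₀ I 𝒟 1` of T-DIRLIFT part D), an
isomorphism `e : V(𝓔) ≅ V(E₁)` OVER `ρ`. The transported centre is `C̃ := 𝓔 ⊔ C₁·𝒪_X`.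
* `comap_subschemeι_self` — `I·𝒪_{V(I)} = 0`; `transportedCentre_comap_subschemeι` — `C̃·𝒪_{V(𝓔)} = e^*(C₁·𝒪_{V(E₁)})`;
* **`exists_iso_subscheme_transportedCentre`** — `V(C̃) ≅ V(C₁)` over `ρ` (so regularity, integrality, flatness and the `ℙ¹_O`-structure transport:
  `isRegular_transportedCentre`, `flat_transportedCentre`);
* `isEffectiveCartier_transportedCentre_comap` — `C̃` cuts an effective Cartier divisor on `V(𝓔)` if `C₁` does on `V(E₁)` (input of 051's
  `exists_iso_subscheme_strictTransformIdeal_exceptional` p545368 for the OLD surface, and of the density engine p564222);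
* **`exists_twoFrame_transportedCentre`** — quasi-regular 2-frames `(ε, g̃)` of `C̃` at its points (`ε` a Cartier equation of `𝓔`, `g̃` a lift of the
  Cartier equation of `C̃|_{V(𝓔)}`; Matsumura 16.2 (i) in the tree's elementwise form `isQuasiRegular_of_regularSeq`) = input (c) of `DirLift.ruled_round_root`;
* **`transportedCentre_comap_eq_vanishingIdeal`** — with a cartesian square of special fibres `jG ≫ ρ = ϱ ≫ j₁` and exact reduced traces
  `𝓔·𝒪_G = 𝓘⟨E⟩`, `C₁·𝒪_{G₁} = 𝓘⟨Γ₁⟩`: `C̃·𝒪_G = 𝓘⟨E ∩ ϱ⁻¹Γ₁⟩` (051's (T1)/(T2b) p549332) — `= 𝓘⟨Z⟩` for the section `Z ⊆ E` pushed down to `Γ₁`.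

References (index only): res-D-pv-051 …NatConeRoundTransport p549332 ((T1)/(T2)), …NatConeRoundCentre (`exists_iso_subscheme_comap_subschemeι_of_le`),
p545368; res-L1-w45b-stub-2 …NatTowerRuledDefs p561677, …NatTowerRuledRoots p562947, …NatTowerExceptionalDense p564222, …NatSpecialFibreIso;
Literature `isPullback_subschemeMap`, `IsEffectiveCartier.comap_iso`, `isQuasiRegular_of_regularSeq`. [cite: Matsumura1987, Thm. 16.2 (i)]
[cite: GortzWedhorn2020, Prop. 4.20] (index only).
-/

set_option linter.dupNamespace false -- mandated namespace `Summit.<Summit>.<Problem>` of this single-conjunct summit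

noncomputable section

open CategoryTheory CategoryTheory.Limits AlgebraicGeometry TopologicalSpace Topology IsLocalRing
open Literature.AlgebraicGeometry.Resolution
open AlgebraicGeometry.Scheme.IdealSheafData

namespace Summit.ResolutionOfSingularities.ResolutionOfSingularities.Cruxes.EquisingularLiftNat.Sections

universe u

/-- `I·𝒪_{V(I)} = 0`: an ideal sheaf restricts to zero on its own closed subscheme. [folklore] -/
theorem comap_subschemeι_self {X : Scheme.{u}} (I : X.IdealSheafData) : I.comap I.subschemeι = ⊥ := by
  rw [Scheme.IdealSheafData.comap]
  exact Scheme.Hom.ker_eq_bot_of_isIso _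

section Transport

variable {X X₁ : Scheme.{0}} (ρ : X ⟶ X₁) (𝓔 : X.IdealSheafData) (E₁ C₁ : X₁.IdealSheafData)
  (e : 𝓔.subscheme ≅ E₁.subscheme)

/-- **The transported centre restricted to `V(𝓔)` is the pull-back along `e` of `C₁|_{V(E₁)}`.** [folklore] -/
theorem transportedCentre_comap_subschemeι (he : e.hom ≫ E₁.subschemeι = 𝓔.subschemeι ≫ ρ) :
    (𝓔 ⊔ C₁.comap ρ).comap 𝓔.subschemeι = (C₁.comap E₁.subschemeι).comap e.hom := by
  rw [Scheme.IdealSheafData.comap_sup, comap_subschemeι_self, bot_sup_eq, ← Scheme.IdealSheafData.comap_comp, ← he,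
    Scheme.IdealSheafData.comap_comp]

/-- **`V(C̃) ≅ V(C₁)` over `ρ`** for the transported centre `C̃ = 𝓔 ⊔ C₁·𝒪_X`: `V(C̃) = V(C̃|_{V(𝓔)}) = V(e^*(C₁|_{V(E₁)})) ≅ V(C₁|_{V(E₁)}) = V(C₁)`.
[cite: GortzWedhorn2020, Prop. 4.20] [OURS · L1 W4.5b · S6 (d)] -/
theorem exists_iso_subscheme_transportedCentre (hEC : E₁ ≤ C₁) (he : e.hom ≫ E₁.subschemeι = 𝓔.subschemeι ≫ ρ) :
    ∃ ee : (𝓔 ⊔ C₁.comap ρ).subscheme ≅ C₁.subscheme, ee.hom ≫ C₁.subschemeι = (𝓔 ⊔ C₁.comap ρ).subschemeι ≫ ρ := by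
  -- (i) `V(C̃|_{V(𝓔)}) ≅ V(C̃)` over `ι_𝓔`, read on `e^*(C₁|_{V(E₁)})`
  have hA : ∃ a : ((C₁.comap E₁.subschemeι).comap e.hom).subscheme ≅ (𝓔 ⊔ C₁.comap ρ).subscheme,
      a.hom ≫ (𝓔 ⊔ C₁.comap ρ).subschemeι = ((C₁.comap E₁.subschemeι).comap e.hom).subschemeι ≫ 𝓔.subschemeι := by
    rw [← transportedCentre_comap_subschemeι ρ 𝓔 E₁ C₁ e he]
    exact exists_iso_subscheme_comap_subschemeι_of_le (I := 𝓔 ⊔ C₁.comap ρ) (J := 𝓔) le_sup_left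
  obtain ⟨a, ha⟩ := hA
  -- (ii) `V(e^*(C₁|_{V(E₁)})) ≅ V(C₁|_{V(E₁)})` over `e`
  have hB := isPullback_subschemeMap e.hom (C₁.comap E₁.subschemeι)
  haveI : IsIso (subschemeMap ((C₁.comap E₁.subschemeι).comap e.hom) (C₁.comap E₁.subschemeι) e.hom
      ((C₁.comap E₁.subschemeι).le_map_comap e.hom)) := hB.isIso_fst_of_isIso
  -- (iii) `V(C₁|_{V(E₁)}) ≅ V(C₁)` over `ι_{E₁}`
  obtain ⟨c, hc⟩ := exists_iso_subscheme_comap_subschemeι_of_le (I := C₁) (J := E₁) hEC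
  refine ⟨a.symm ≪≫ asIso (subschemeMap ((C₁.comap E₁.subschemeι).comap e.hom) (C₁.comap E₁.subschemeι) e.hom
      ((C₁.comap E₁.subschemeι).le_map_comap e.hom)) ≪≫ c, ?_⟩
  rw [Iso.trans_hom, Iso.trans_hom, Iso.symm_hom, asIso_hom, Category.assoc, Category.assoc, hc,
    ← Category.assoc (subschemeMap _ _ _ _) _ E₁.subschemeι, subschemeMap_subschemeι, Category.assoc, he,
    ← Category.assoc _ 𝓔.subschemeι ρ, ← ha, Category.assoc, Iso.inv_hom_id_assoc]

/-- Regularity of `V(C₁)` transports to `V(C̃)`. [folklore] -/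
theorem isRegular_transportedCentre (hEC : E₁ ≤ C₁) (he : e.hom ≫ E₁.subschemeι = 𝓔.subschemeι ≫ ρ) (hreg : Scheme.IsRegular C₁.subscheme) : Scheme.IsRegular (𝓔 ⊔ C₁.comap ρ).subscheme := by
  obtain ⟨ee, -⟩ := exists_iso_subscheme_transportedCentre ρ 𝓔 E₁ C₁ e hEC he
  intro a
  haveI := hreg (ee.hom a)
  exact IsRegularLocalRing.of_ringEquiv (asIso (ee.hom.stalkMap a)).commRingCatIsoToRingEquiv

/-- Flatness over the base transports to `V(C̃)`. [folklore] -/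
theorem flat_transportedCentre (hEC : E₁ ≤ C₁) (he : e.hom ≫ E₁.subschemeι = 𝓔.subschemeι ≫ ρ) {S : Scheme.{0}} (f₁ : X₁ ⟶ S) (hflat : Flat (C₁.subschemeι ≫ f₁)) :
    Flat ((𝓔 ⊔ C₁.comap ρ).subschemeι ≫ ρ ≫ f₁) := by
  obtain ⟨ee, hee⟩ := exists_iso_subscheme_transportedCentre ρ 𝓔 E₁ C₁ e hEC he
  have h : (𝓔 ⊔ C₁.comap ρ).subschemeι ≫ ρ ≫ f₁ = ee.hom ≫ (C₁.subschemeι ≫ f₁) := by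
    rw [← Category.assoc, ← hee, Category.assoc]
  rw [h]
  infer_instance

/-- **`C̃` cuts an effective Cartier divisor on `V(𝓔)` if `C₁` does on `V(E₁)`.** [folklore] -/
theorem isEffectiveCartier_transportedCentre_comap (he : e.hom ≫ E₁.subschemeι = 𝓔.subschemeι ≫ ρ) (hC : IsEffectiveCartier (C₁.comap E₁.subschemeι)) :
    IsEffectiveCartier ((𝓔 ⊔ C₁.comap ρ).comap 𝓔.subschemeι) := by
  rw [transportedCentre_comap_subschemeι ρ 𝓔 E₁ C₁ e he]
  exact hC.comap_iso e

/-- **Quasi-regular 2-frames of the transported centre**: at every point of `V(C̃)` the pair `(ε, g̃)` — `ε` a Cartier equation of `𝓔`, `g̃` a lift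
of the Cartier equation of `C̃|_{V(𝓔)}` — generates `C̃` and is quasi-regular (`ε` a nonzerodivisor, `g̃` a nonzerodivisor modulo `ε`).
[cite: Matsumura1987, Thm. 16.2 (i)] [OURS · L1 W4.5b · S6 (d)] input (c) of `DirLift.ruled_round_root`. -/
theorem exists_twoFrame_transportedCentre (he : e.hom ≫ E₁.subschemeι = 𝓔.subschemeι ≫ ρ) (hε : IsEffectiveCartier 𝓔) (hC : IsEffectiveCartier (C₁.comap E₁.subschemeι)) :
    ∀ x ∈ (𝓔 ⊔ C₁.comap ρ).support, ∃ c : Fin 2 → X.presheaf.stalk x,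
      Ideal.span (Set.range c) = stalkIdeal (𝓔 ⊔ C₁.comap ρ) x ∧ IsQuasiRegular c := by
  intro x hx
  have hxE : x ∈ 𝓔.support := by
    have h : x ∈ ((𝓔 ⊔ C₁.comap ρ).support : Set X) := hx
    rw [Scheme.IdealSheafData.support_sup] at h
    exact h.1
  have hx' : x ∈ Set.range 𝓔.subschemeι := by rw [Scheme.IdealSheafData.range_subschemeι]; exact hxE
  obtain ⟨y, rfl⟩ := hx'
  -- `φ : 𝒪_{X,x} ↠ 𝒪_{V(𝓔),y}`, kernel `𝓔_x = (ε)`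
  set φ := (𝓔.subschemeι.stalkMap y).hom with hφ
  have hφsurj : Function.Surjective φ := 𝓔.subschemeι.stalkMap_surjective y
  have hφker : RingHom.ker φ = stalkIdeal 𝓔 (𝓔.subschemeι y) := by
    rw [hφ, ← stalkIdeal_ker_eq_ker_stalkMap, Scheme.IdealSheafData.ker_subschemeι]
  obtain ⟨ε, hεreg, hεspan⟩ := hε.exists_stalkIdeal_eq_span (𝓔.subschemeι y)
  -- the Cartier equation `g` of `C̃|_{V(𝓔)}` at `y`, lifted to `g̃`
  obtain ⟨g, hgreg, hgspan⟩ := (isEffectiveCartier_transportedCentre_comap ρ 𝓔 E₁ C₁ e he hC).exists_stalkIdeal_eq_span y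
  obtain ⟨g', hg'⟩ := hφsurj g
  -- `C̃_x = (ε, g̃)`
  have hCx : stalkIdeal (𝓔 ⊔ C₁.comap ρ) (𝓔.subschemeι y) = Ideal.span {ε} ⊔ Ideal.span {g'} := by
    have h1 : (stalkIdeal (𝓔 ⊔ C₁.comap ρ) (𝓔.subschemeι y)).map φ = (Ideal.span {g'}).map φ := by
      rw [hφ, ← stalkIdeal_comap_eq_map_stalkMap, hgspan, Ideal.map_span, Set.image_singleton]
      exact congrArg _ (by rw [hg'])
    have h2 := congrArg (Ideal.comap φ) h1
    rw [Ideal.comap_map_of_surjective _ hφsurj, Ideal.comap_map_of_surjective _ hφsurj, ← RingHom.ker_eq_comap_bot, hφker] at h2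
    have hle : stalkIdeal 𝓔 (𝓔.subschemeι y) ≤ stalkIdeal (𝓔 ⊔ C₁.comap ρ) (𝓔.subschemeι y) := stalkIdeal_mono le_sup_left _
    rw [sup_eq_left.mpr hle] at h2
    rw [h2, hεspan, sup_comm]
  refine ⟨![ε, g'], ?_, ?_⟩
  · rw [hCx]
    have hr : Set.range ![ε, g'] = {ε, g'} := by
      ext t
      simp only [Set.mem_range, Set.mem_insert_iff, Set.mem_singleton_iff]
      constructor
      · rintro ⟨i, rfl⟩
        rcases Fin.exists_fin_two.mp ⟨i, rfl⟩ with rfl | rfl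
        · exact Or.inl rfl
        · exact Or.inr rfl
      · rintro (rfl | rfl)
        · exact ⟨0, rfl⟩
        · exact ⟨1, rfl⟩
    rw [hr, Ideal.span_insert]
  · refine isQuasiRegular_of_regularSeq 2 ![ε, g'] fun i z hz => ?_
    rcases Fin.exists_fin_two.mp ⟨i, rfl⟩ with rfl | rfl
    · -- `ε` is a nonzerodivisor
      have h0 : Set.Iio (0 : Fin 2) = ∅ := by ext j; simp
      rw [h0, Set.image_empty, Ideal.span_empty] at hz ⊢
      rw [Ideal.mem_bot] at hz ⊢
      simp only [Matrix.cons_val_zero] at hz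
      exact (mem_nonZeroDivisors_iff_right.mp hεreg) z (by rw [mul_comm]; exact hz)
    · -- `g̃` is a nonzerodivisor modulo `ε`
      have h1 : ![ε, g'] '' Set.Iio (1 : Fin 2) = {ε} := by
        ext t
        simp only [Set.mem_image, Set.mem_Iio, Set.mem_singleton_iff]
        constructor
        · rintro ⟨j, hj, rfl⟩
          have : j = 0 := by
            rcases Fin.exists_fin_two.mp ⟨j, rfl⟩ with rfl | rfl
            · rfl
            · exact absurd hj (lt_irrefl _)
          subst this; rfl
        · rintro rfl; exact ⟨0, by decide, rfl⟩
      rw [h1] at hz ⊢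
      simp only [Matrix.cons_val_one, Matrix.cons_val_zero] at hz
      rw [← hεspan, ← hφker, RingHom.mem_ker] at hz ⊢
      rw [map_mul, hg'] at hz
      exact (mem_nonZeroDivisors_iff_right.mp hgreg) _ (by rw [mul_comm]; exact hz)

/-- **The special fibre of the transported centre.** With a cartesian square of special fibres `jG ≫ ρ = ϱ ≫ j₁` and exact reduced traces
`𝓔·𝒪_G = 𝓘⟨E⟩`, `C₁·𝒪_{G₁} = 𝓘⟨Γ₁⟩`, the transported centre has the exact reduced trace `C̃·𝒪_G = 𝓘⟨E ∩ ϱ⁻¹ Γ₁⟩` (= `𝓘⟨Z⟩` for the section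
`Z ⊆ E` pushed down onto `Γ₁`). [cite: GortzWedhorn2020, Prop. 4.20] [OURS · L1 W4.5b · S6 (d)] -/
theorem transportedCentre_comap_eq_vanishingIdeal (hEC : E₁ ≤ C₁) (he : e.hom ≫ E₁.subschemeι = 𝓔.subschemeι ≫ ρ) {G G₁ : Scheme.{0}} (jG : G ⟶ X) (j₁ : G₁ ⟶ X₁) (ϱ : G ⟶ G₁)
    (hcart : IsPullback jG ϱ ρ j₁) {E : Set G} (hEcl : IsClosed E) (hEtr : 𝓔.comap jG = vanishingIdeal ⟨E, hEcl⟩)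
    {Γ₁ : Set G₁} (hΓcl : IsClosed Γ₁) (hΓtr : C₁.comap j₁ = vanishingIdeal ⟨Γ₁, hΓcl⟩) :
    (𝓔 ⊔ C₁.comap ρ).comap jG = vanishingIdeal ⟨E ∩ ϱ ⁻¹' Γ₁, hEcl.inter (hΓcl.preimage ϱ.continuous)⟩ := by
  obtain ⟨ee, hee⟩ := exists_iso_subscheme_transportedCentre ρ 𝓔 E₁ C₁ e hEC he
  have h := comap_eq_vanishingIdeal_support_of_iso_over hcart (𝓔 ⊔ C₁.comap ρ) C₁ ee hee ⟨Γ₁, hΓcl⟩ hΓtr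
  rw [h]
  congr 1
  apply Closeds.ext
  change ((((𝓔 ⊔ C₁.comap ρ).comap jG).support : Closeds G) : Set G) = E ∩ ϱ ⁻¹' Γ₁
  rw [Scheme.IdealSheafData.support_comap, Scheme.IdealSheafData.support_sup, Closeds.coe_preimage, Closeds.coe_inf,
    Set.preimage_inter]
  congr 1
  · have h1 : ((𝓔.comap jG).support : Set G) = E := by
      rw [hEtr, Scheme.IdealSheafData.coe_support_vanishingIdeal]; rfl
    rw [Scheme.IdealSheafData.support_comap, Closeds.coe_preimage] at h1
    exact h1
  · have h2 : ((C₁.comap j₁).support : Set G₁) = Γ₁ := by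
      rw [hΓtr, Scheme.IdealSheafData.coe_support_vanishingIdeal]; rfl
    rw [Scheme.IdealSheafData.support_comap, Closeds.coe_preimage] at h2
    rw [Scheme.IdealSheafData.support_comap, Closeds.coe_preimage, ← h2, ← Set.preimage_comp, ← Set.preimage_comp]
    congr 1
    ext x
    change ρ (jG x) = j₁ (ϱ x)
    rw [← Scheme.Hom.comp_apply, hcart.w, Scheme.Hom.comp_apply]

end Transport

end Summit.ResolutionOfSingularities.ResolutionOfSingularities.Cruxes.EquisingularLiftNat.Sections

end
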